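import Summits.AnomalousDissipation.AnomalousDissipation.Theorems.SolenoidalFractalHomogenisationLagrangianStepVmodSSBlockGrid
import Summits.AnomalousDissipation.AnomalousDissipation.Theorems.SolenoidalFractalHomogenisationLagrangianStepVmodFlatBlocksP
import HarnessLib

/-!
# K1L_D (stmt-AnomalousDissipation-27980): (V_mod) flat stage — THE (ss) BLOCK OF RECORD `Bss_textEHP (fun σ => min (σ/2) (1/2))` IS A THEOREM
# (grid-phase family of RULING D28-9, text `…VmodFlatBlocksP` p721357; body = prover ad-sawtooth-k1loc-p1 g15's `VmodFlat.inner_sub_le_slow_grid`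
# p723182; bridge by prover ad-k1loc-p3 g11 per D28-14 «bssP_of_ssMode_grid», `--supports 27980 --as helper`)

The one-line let-binder bridge (same as `…VmodFsGridBlockP.bfsP_of_exponent`): p1 g15's grid (ss) block carries the window binder
`(∃ j : ℕ, s = j·(M·W.period/ν))` after `t ≤ Tw`; k3l g10's `BlockBoundP` carries `∀ j t, let s := j·(M·W.period/ν); s < t → t ≤ Tw → …`;
`0 ≤ s` is discharged from `0 < M`, `0 < W.period`, `0 < ν`.
* `bssP_of_exponent` — `Bss_textEHP e` for every exponent map with `0 ≤ e σ ≤ min(σ/2, 1/2)` on `σ > 0`;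
* **`bssP_half : Bss_textEHP (fun σ => min (σ / 2) (1 / 2))`** — input 1/4 of `lossFlatWP_of_blocksEVHP` at the exponent of the texts of record.
`sorry`-free; NOT a proof of (sf)/(ff), of `stub_Vmod_EHTthg`, of K1L_D or of AD; rung F-D1.A0.
-/

set_option linter.dupNamespace false

noncomputable section

namespace Summit.AnomalousDissipation.AnomalousDissipation.Theorems.SolenoidalFractalHomogenisation.LagrangianStep.VmodFlat

open Literature.Analysis Literature.Analysis.FluidPDE Literature.Analysis.FunctionSpaces
open MeasureTheory Set Filter UnitAddTorus
open scoped ENNReal NNReal InnerProductSpace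
open Summit.AnomalousDissipation.AnomalousDissipation.Theorems.SolenoidalFractalHomogenisation.LagrangianStep.CellClauseMod
open Summit.AnomalousDissipation.AnomalousDissipation.Theorems.SolenoidalFractalHomogenisation.LagrangianStep.LossCurrency

/-- **(ss) on the grid, any admissible exponent map**: `Bss_textEHP e` whenever `0 ≤ e σ ≤ min(σ/2, 1/2)` for every `σ > 0`
(p1 g15's `inner_sub_le_slow_grid` through the let-binder of `BlockBoundP`). -/
theorem bssP_of_exponent (e : ℝ → ℝ) (he : ∀ σ, 0 < σ → 0 ≤ e σ ∧ e σ ≤ σ / 2 ∧ e σ ≤ 1 / 2) : Bss_textEHP e := by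
  intro k W M hM c hc Φ lo hi Λ β σ C ν₀ K hlo hlo1 hhi hΛ hβ hσ hC hν₀ hν₀1 hK hV hH
  obtain ⟨C₁, hC₁, h⟩ := inner_sub_le_slow_grid e he k W M hM c hc Φ lo hi Λ β σ C ν₀ K hlo hlo1 hhi hΛ hβ hσ hC hν₀ hν₀1 hK hV hH
  refine ⟨C₁, hC₁, ?_⟩
  intro ν hν n hn 𝔸 hodd hwin hΦo hΦw Tw hTw U T hU hT j t s hst htT x ζ hx hζ
  have hs : 0 ≤ s := by
    show (0:ℝ) ≤ (j : ℝ) * (M * W.period / ν)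
    exact mul_nonneg (Nat.cast_nonneg j) (div_nonneg (mul_nonneg hM.le
      (Summit.AnomalousDissipation.AnomalousDissipation.Theorems.SolenoidalFractalHomogenisation.PermissibleCarrier.period_pos W).le) hν.1.le)
  exact h ν hν n hn 𝔸 hodd hwin hΦo hΦw Tw hTw U T hU hT s t hs hst htT ⟨j, rfl⟩ x ζ hx hζ

/-- **THE (ss) BLOCK OF RECORD IS A THEOREM**: `Bss_textEHP (fun σ => min (σ/2) (1/2))` — the first input of `lossFlatWP_of_blocksEVHP`
(k3l g10, p721357) at the exponent of the registered texts. -/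
theorem bssP_half : Bss_textEHP (fun σ => min (σ / 2) (1 / 2)) :=
  bssP_of_exponent _ fun σ hσ => ⟨le_min (by linarith) (by norm_num), min_le_left _ _, min_le_right _ _⟩

end Summit.AnomalousDissipation.AnomalousDissipation.Theorems.SolenoidalFractalHomogenisation.LagrangianStep.VmodFlat

end
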